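import Summits.AtomisticToContinuum.HydrodynamicLimit.Theorems.JParityClosureRateFloorCountTransfer
import Literature.Analysis.FluidPDE.HardSphereCollisionRecord
import Literature.MathematicalPhysics.KineticTheory.HardSphereEuler

/-!
# `JParityClosure.RateFloor` (stmt-AtomisticToContinuum-13080), line `Sketch`, stub S8:
# the pathwise transfer `stub_pathwiseTransfer`

Helper file (`--supports stmt-AtomisticToContinuum-13080`) discharging the registered stub S8
`stub_pathwiseTransfer` of the lead's skeleton for the crux `JParityClosure.RateFloor`, line
`Sketch`, stated exactly as registered: one antecedent, the text of the neighbouring stub S6d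
(marked realised transfer on one window `(s, t]`: for every nonnegative mark `F`, the marks of
the realised would-be pairs of the window, read at their free-flight-predicted data, sum to at
most the window's collision functional with the same mark), then the conclusion.

**Statement.**  On a hard-sphere trajectory `γ` on `𝕋³` with diameter `0 < ε < 1/2`, for
windows of length `Δ > 0`, a horizon `τ ≥ 0`, a nonnegative mark `F u x y v w`, the first
near-contact times `t₁ k p` of the free flights issued from the window starts `γ (kΔ)` and the
realised would-be pairs `R k` of the windows, the predicted marks summed over the `⌊τ/Δ⌋₊`
windows `(kΔ, kΔ + Δ]` inside `[0, τ]` are at most the collision functional of `[0, τ]`,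
`∑ᶠ_{u ∈ collisionTimes ∩ [0, τ]} ∑ᵢ ∑ⱼ 1[i ≠ j, ‖xᵢ(u) − xⱼ(u)‖ = ε] F u xᵢ(u) xⱼ(u) pv.1 pv.2`
(`pv` the current velocities reflected across the separation vector).

**Proof.**  (1) Per window `(kΔ, kΔ + Δ]`, `k < ⌊τ/Δ⌋₊`, the antecedent with `s := kΔ`,
`t := kΔ + Δ` (so `t − s = Δ`, `add_sub_cancel_left`) bounds the window's predicted marks by
the window's collision functional, a `finsum` over `collisionTimes ∩ (kΔ, kΔ + Δ]`.
(2) The windows lie inside `[0, τ]` (`0 ≤ kΔ`, `(k+1)Δ ≤ ⌊τ/Δ⌋₊Δ ≤ τ` by `Nat.floor_le`), so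
each window `finsum` is the finite sum over the part of the finite set
`collisionTimes ∩ [0, τ]` (`IsHardSphereTrajectory.locFinite`) cut out by the window
(`finsum_mem_coe_finset`).  (3) The windows are pairwise disjoint and the summands are
nonnegative, so the window sums add up to at most the sum over all collision times of `[0, τ]`
(`RateFloorCountTransfer.sum_range_sum_filter_window_le`), which is the `finsum` of the
statement (`finsum_mem_eq_finite_toFinset_sum`).

References: Gallagher–Saint-Raymond–Texier 2013 §4.1 (hard-sphere trajectories); elementary.
-/

noncomputable section

open scoped Classical BigOperators

namespace Summit.AtomisticToContinuum.HydrodynamicLimit.Theorems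

open MeasureTheory Set Filter Topology
open Literature.Analysis.FluidPDE Literature.MathematicalPhysics.KineticTheory

namespace RateFloorPathwiseTransfer

variable {d : Type*} [Fintype d] {X : Type*} [TopologicalSpace X] {N : ℕ} {G : Geometry d X}
  {ε : ℝ} {γ : ℝ → Config N d X}

/-- On a hard-sphere trajectory, the `finsum` of a real function over the collision times of a
window `(s, t] ⊆ [a, b]` is its finite sum over the collision times of `[a, b]` lying in
`(s, t]`. [folklore] -/
theorem finsum_mem_inter_Ioc_eq_sum_filter (h : IsHardSphereTrajectory G ε N γ) (g : ℝ → ℝ)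
    {s t a b : ℝ} (hst : Set.Ioc s t ⊆ Set.Icc a b) :
    ∑ᶠ (u : ℝ) (_ : u ∈ collisionTimes G ε γ ∩ Set.Ioc s t), g u =
      ∑ u ∈ (h.locFinite a b).toFinset.filter (fun u => u ∈ Set.Ioc s t), g u := by
  have hset : collisionTimes G ε γ ∩ Set.Ioc s t =
      ↑((h.locFinite a b).toFinset.filter (fun u => u ∈ Set.Ioc s t)) := by
    ext u
    simp only [Finset.coe_filter, Set.mem_setOf_eq, Set.Finite.mem_toFinset, Set.mem_inter_iff]
    exact ⟨fun ⟨hc, hu⟩ => ⟨⟨hc, hst hu⟩, hu⟩, fun ⟨⟨hc, _⟩, hu⟩ => ⟨hc, hu⟩⟩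
  rw [hset, finsum_mem_coe_finset]

/-- **Window summation against a nonnegative functional.**  If window by window
(`(kΔ, kΔ + Δ]`, `k < ⌊τ/Δ⌋₊`) the numbers `a k` are at most the `finsum` of a nonnegative
function `g` over the collision times of the window, then `∑_{k < ⌊τ/Δ⌋₊} a k` is at most the
`finsum` of `g` over the collision times of `[0, τ]`. [folklore] -/
theorem sum_range_le_finsum_mem_inter_Icc (h : IsHardSphereTrajectory G ε N γ) {Δ τ : ℝ}
    (hΔ : 0 < Δ) (hτ : 0 ≤ τ) (g : ℝ → ℝ) (hg : ∀ u, 0 ≤ g u) (a : ℕ → ℝ)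
    (ha : ∀ k : ℕ, k < ⌊τ / Δ⌋₊ →
      a k ≤ ∑ᶠ (u : ℝ) (_ : u ∈ collisionTimes G ε γ ∩ Set.Ioc ((k : ℝ) * Δ) (k * Δ + Δ)), g u) :
    ∑ k ∈ Finset.range ⌊τ / Δ⌋₊, a k ≤
      ∑ᶠ (u : ℝ) (_ : u ∈ collisionTimes G ε γ ∩ Set.Icc 0 τ), g u := by
  rw [finsum_mem_eq_finite_toFinset_sum _ (h.locFinite 0 τ)]
  have hn : (⌊τ / Δ⌋₊ : ℝ) * Δ ≤ τ := (le_div_iff₀ hΔ).1 (Nat.floor_le (div_nonneg hτ hΔ.le))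
  calc ∑ k ∈ Finset.range ⌊τ / Δ⌋₊, a k
      ≤ ∑ k ∈ Finset.range ⌊τ / Δ⌋₊, ∑ u ∈ (h.locFinite 0 τ).toFinset.filter
            (fun u => u ∈ Set.Ioc ((k : ℝ) * Δ) (k * Δ + Δ)), g u := by
        refine Finset.sum_le_sum fun k hk => (ha k (Finset.mem_range.1 hk)).trans_eq ?_
        have hk1 : ((k : ℝ) + 1) * Δ ≤ ⌊τ / Δ⌋₊ * Δ :=
          mul_le_mul_of_nonneg_right
            (by exact_mod_cast Nat.lt_iff_add_one_le.1 (Finset.mem_range.1 hk)) hΔ.le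
        have hk0 : 0 ≤ (k : ℝ) * Δ := mul_nonneg k.cast_nonneg hΔ.le
        exact finsum_mem_inter_Ioc_eq_sum_filter h g
          fun u hu => ⟨by linarith [hu.1], by linarith [hu.2]⟩
    _ ≤ ∑ u ∈ (h.locFinite 0 τ).toFinset, g u :=
        RateFloorCountTransfer.sum_range_sum_filter_window_le _ _ (fun u _ => hg u) hΔ _

/-- **S8 · pathwise transfer** (registered stub `stub_pathwiseTransfer` of the line `Sketch`
for `JParityClosure.RateFloor`, verbatim).  Given the marked realised transfer on one window
(the text of the neighbouring stub S6d) as hypothesis: on a hard-sphere trajectory on `𝕋³`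
with `0 < ε < 1/2`, for windows of length `Δ > 0`, a horizon `τ ≥ 0` and a nonnegative mark
`F`, the predicted marks of the realised would-be pairs of the window starts, summed over the
`⌊τ/Δ⌋₊` windows, are at most the collision functional of `[0, τ]` with the same mark.
[folklore] -/
theorem stub_pathwiseTransfer :
    (∀ (N : ℕ) (ε : ℝ) (γ : ℝ → Config N (Fin 3) T3),
    IsHardSphereTrajectory (Torus.geometry (Fin 3)) ε N γ → 0 < ε → ε < 2⁻¹ →
    ∀ (s t : ℝ), s < t →
      ∀ (F : ℝ → T3 → T3 → V3 → V3 → ℝ), (∀ u x y v w, 0 ≤ F u x y v w) →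
      ∀ (t₁ : Fin N × Fin N → ℝ),
      (∀ p, t₁ p = sInf {u : ℝ | u ∈ Set.Ioc 0 (t - s) ∧ ‖(Torus.geometry (Fin 3)).sepVec
          (freeFlight (Torus.geometry (Fin 3)) u (γ s) p.1).1 (freeFlight (Torus.geometry (Fin 3)) u (γ s) p.2).1‖ ≤ ε}) →
      ∀ (R : Finset (Fin N × Fin N)),
      (R = Finset.univ.filter fun p => p.1 ≠ p.2 ∧
        (∃ u ∈ Set.Ioc 0 (t - s), ‖(Torus.geometry (Fin 3)).sepVec
          (freeFlight (Torus.geometry (Fin 3)) u (γ s) p.1).1 (freeFlight (Torus.geometry (Fin 3)) u (γ s) p.2).1‖ ≤ ε) ∧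
        (∀ u ∈ Set.Ioo s (s + t₁ p), ¬ Participates (Torus.geometry (Fin 3)) ε (γ u) p.1) ∧
        (∀ u ∈ Set.Ioo s (s + t₁ p), ¬ Participates (Torus.geometry (Fin 3)) ε (γ u) p.2)) →
      ∑ p ∈ R, F (s + t₁ p) (freeFlight (Torus.geometry (Fin 3)) (t₁ p) (γ s) p.1).1 (freeFlight (Torus.geometry (Fin 3)) (t₁ p) (γ s) p.2).1
          ((γ s p.1).2) ((γ s p.2).2) ≤
        ∑ᶠ (u : ℝ) (_ : u ∈ collisionTimes (Torus.geometry (Fin 3)) ε γ ∩ Set.Ioc s t),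
          ∑ i : Fin N, ∑ j : Fin N,
            (if i ≠ j ∧ ‖(Torus.geometry (Fin 3)).sepVec (γ u i).1 (γ u j).1‖ = ε then
              F u (γ u i).1 (γ u j).1
                (reflectVel ((Torus.geometry (Fin 3)).sepVec (γ u i).1 (γ u j).1) ((γ u i).2, (γ u j).2)).1
                (reflectVel ((Torus.geometry (Fin 3)).sepVec (γ u i).1 (γ u j).1) ((γ u i).2, (γ u j).2)).2
            else 0)) →
    ∀ (N : ℕ) (ε : ℝ) (γ : ℝ → Config N (Fin 3) T3),
    IsHardSphereTrajectory (Torus.geometry (Fin 3)) ε N γ → 0 < ε → ε < 2⁻¹ →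
    ∀ (Δ τ : ℝ), 0 < Δ → 0 ≤ τ →
      ∀ (F : ℝ → T3 → T3 → V3 → V3 → ℝ), (∀ u x y v w, 0 ≤ F u x y v w) →
      ∀ (t₁ : ℕ → Fin N × Fin N → ℝ),
      (∀ (k : ℕ) (p : Fin N × Fin N), t₁ k p = sInf {u : ℝ | u ∈ Set.Ioc 0 Δ ∧ ‖(Torus.geometry (Fin 3)).sepVec
          (freeFlight (Torus.geometry (Fin 3)) u (γ (k * Δ)) p.1).1 (freeFlight (Torus.geometry (Fin 3)) u (γ (k * Δ)) p.2).1‖ ≤ ε}) →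
      ∀ (R : ℕ → Finset (Fin N × Fin N)),
      (∀ k : ℕ, R k = Finset.univ.filter fun p => p.1 ≠ p.2 ∧
        (∃ u ∈ Set.Ioc 0 Δ, ‖(Torus.geometry (Fin 3)).sepVec
          (freeFlight (Torus.geometry (Fin 3)) u (γ (k * Δ)) p.1).1 (freeFlight (Torus.geometry (Fin 3)) u (γ (k * Δ)) p.2).1‖ ≤ ε) ∧
        (∀ u ∈ Set.Ioo (k * Δ) (k * Δ + t₁ k p), ¬ Participates (Torus.geometry (Fin 3)) ε (γ u) p.1) ∧
        (∀ u ∈ Set.Ioo (k * Δ) (k * Δ + t₁ k p), ¬ Participates (Torus.geometry (Fin 3)) ε (γ u) p.2)) →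
      ∑ k ∈ Finset.range ⌊τ / Δ⌋₊, ∑ p ∈ R k,
          F (k * Δ + t₁ k p) (freeFlight (Torus.geometry (Fin 3)) (t₁ k p) (γ (k * Δ)) p.1).1
            (freeFlight (Torus.geometry (Fin 3)) (t₁ k p) (γ (k * Δ)) p.2).1 ((γ (k * Δ) p.1).2) ((γ (k * Δ) p.2).2) ≤
        ∑ᶠ (u : ℝ) (_ : u ∈ collisionTimes (Torus.geometry (Fin 3)) ε γ ∩ Set.Icc 0 τ),
          ∑ i : Fin N, ∑ j : Fin N,
            (if i ≠ j ∧ ‖(Torus.geometry (Fin 3)).sepVec (γ u i).1 (γ u j).1‖ = ε then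
              F u (γ u i).1 (γ u j).1
                (reflectVel ((Torus.geometry (Fin 3)).sepVec (γ u i).1 (γ u j).1) ((γ u i).2, (γ u j).2)).1
                (reflectVel ((Torus.geometry (Fin 3)).sepVec (γ u i).1 (γ u j).1) ((γ u i).2, (γ u j).2)).2
            else 0) := by
  intro hS6d N ε γ h hε hε2 Δ τ hΔ hτ F hF t₁ ht₁ R hR
  refine sum_range_le_finsum_mem_inter_Icc h hΔ hτ _ (fun u => ?_) _ (fun k _ => ?_)
  · refine Finset.sum_nonneg fun i _ => Finset.sum_nonneg fun j _ => ?_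
    split_ifs
    · exact hF _ _ _ _ _
    · exact le_rfl
  · refine hS6d N ε γ h hε hε2 (k * Δ) (k * Δ + Δ) (by linarith) F hF (t₁ k) (fun p => ?_) (R k) ?_
    · rw [add_sub_cancel_left]
      exact ht₁ k p
    · rw [add_sub_cancel_left]
      exact hR k

end RateFloorPathwiseTransfer

end Summit.AtomisticToContinuum.HydrodynamicLimit.Theorems

end
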